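import Summits.Ventures.PercRepro.S2SharpCore
import Summits.Ventures.PercRepro.S2SharpCellsA
import Summits.Ventures.PercRepro.S2SharpCellsB
import Summits.Ventures.PercRepro.S2CoreTwentySix
import Summits.Ventures.PercRepro.RankLevelSetLevelFivePart
import Summits.Ventures.PercRepro.S2FiveWindow
import Summits.Ventures.PercRepro.S1LevelFourF

/-!
# PercRepro — THEOREM C₅ AT `27`: THE SHARPENED PAIR COUNTS (p7, gen 3; sub-claim S2)

The «31» / «30» chains count the pairs `(C, B′)` of the level count with the factor `C(n, q + 1 − k)` for `B′`; since
`B′` avoids its circuit the factor is `C(n − k, q + 1 − k)` (S2SharpPairs), and the same for the giant flat. With this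
count the cells `(p, d)`, `6 ≤ d ≤ 25`, close with a free slack down to `p = 26` (S2CellsP26 … S2TailP31, numeral checks;
`p = 25` fails at `d = 6, 8, 10, 14`); the coranks `≥ 26` at `p = 26` close by `#Y ≥ Σ_{s=20}^{25} C(n, s)`
(S2CoreTwentySix), at `p ≥ 27` by `c025_core_five_nineteen`; the coranks `6 … 25` at `p ≥ 32` by the partition chain's
core (`c025_core_five_bounded_corank_part`). Hence:

* **`c025_core_five_sharp_cells`** — the `e`-free core at level `5`, corank `6 ≤ d ≤ 25`, every `p ≥ 26`;
* **`c025_five_of_four_sharp_from`** — for `P ≥ 26`, level `4` for all `p ≥ P` implies level `5` for all `p ≥ P + 1`;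
* **`c025_five_large_sharp27`** — UNCONDITIONAL over the landed tree: C-025 at level `5` for every `p ≥ 27` (level `4`
  from S1's `c025_four_seventeen`, `p ≥ 17`); `c025_five_large_sharp27'` is the `C025` spelling.
Axioms: standard.
-/

open scoped Matroid

namespace PercRepro

namespace ThmN

open Set

variable {α : Type}

/-- **The `e`-free core at level `5`, corank `6 ≤ d ≤ 25`, every rank `p ≥ 26`**: `p = 26 … 31` by the sharpened cells,
`p ≥ 32` by the partition chain's core. -/
theorem c025_core_five_sharp_cells (M : Matroid α) [M.Finite] (p d : ℕ) (hp : 26 ≤ p) (hd6 : 6 ≤ d)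
    (hd25 : d ≤ 25) (hR : M.eRank = (p : ℕ∞)) (hn : M.E.ncard = p + d)
    (hfree : ∀ e ∈ M.E, ∃ A ⊆ M.E \ {e}, e ∉ M.closure A ∧ e ∉ M.closure ((M.E \ {e}) \ A)) :
    RLS M p 5 := by
  rcases Nat.lt_or_ge p 32 with h32 | h32
  · rcases Nat.lt_or_ge p 27 with h | h
    · have hp' : p = 26 := by omega
      subst hp'
      exact c025_core_five_sharp_cell M 26 d hd6 hd25 hR hn hfree (S2.cellsP26 d hd6 hd25)
    rcases Nat.lt_or_ge p 28 with h | h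
    · have hp' : p = 27 := by omega
      subst hp'
      exact c025_core_five_sharp_cell M 27 d hd6 hd25 hR hn hfree (S2.cellsP27 d hd6 hd25)
    rcases Nat.lt_or_ge p 29 with h | h
    · have hp' : p = 28 := by omega
      subst hp'
      exact c025_core_five_sharp_cell M 28 d hd6 hd25 hR hn hfree (S2.cellsP28 d hd6 hd25)
    rcases Nat.lt_or_ge p 30 with h | h
    · have hp' : p = 29 := by omega
      subst hp'
      exact c025_core_five_sharp_cell M 29 d hd6 hd25 hR hn hfree (S2.cellsP29 d hd6 hd25)
    rcases Nat.lt_or_ge p 31 with h | h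
    · have hp' : p = 30 := by omega
      subst hp'
      exact c025_core_five_sharp_cell M 30 d hd6 hd25 hR hn hfree (S2.cellsP30 d hd6 hd25)
    · have hp' : p = 31 := by omega
      subst hp'
      exact c025_core_five_sharp_cell M 31 d hd6 hd25 hR hn hfree (S2.cellsP31 d hd6 hd25)
  · exact c025_core_five_bounded_corank_part M p d h32 hd6 hd25 hR hn hfree

/-- **THEOREM C₅, GIVEN LEVEL `4` FROM `P ≥ 26`**: level `4` for all `p ≥ P` implies level `5` for all `p ≥ P + 1`
(coranks `6 … 25` by `c025_core_five_sharp_cells`, `≥ 26` by `c025_core_five_nineteen_at_twentysix` / `c025_core_five_nineteen`). -/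
theorem c025_five_of_four_sharp_from (P : ℕ) (hP : 26 ≤ P)
    (h4 : ∀ (M : Matroid α) [M.Finite] (p : ℕ), P ≤ p → RLS M p 4) :
    ∀ (M : Matroid α) [M.Finite] (p : ℕ), P + 1 ≤ p → RLS M p 5 := by
  refine S2.rls_five_of_four_of_core P (by omega) h4 ?_
  intro M _ p hP' hR hbig hfree
  rcases Nat.lt_or_ge M.E.ncard (p + 26) with h | h
  · exact c025_core_five_sharp_cells M p (M.E.ncard - p) (by omega) (by omega) (by omega) hR (by omega) hfree
  · rcases Nat.lt_or_ge p 27 with h27 | h27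
    · have hp' : p = 26 := by omega
      subst hp'
      exact c025_core_five_nineteen_at_twentysix M (by omega) hfree
    · exact c025_core_five_nineteen M p h27 hR (by omega) hfree

/-- **THEOREM C₅ AT `27`, UNCONDITIONAL**: every finite matroid satisfies C-025 at level `5` for every `p ≥ 27` (level
`4` from S1's `c025_four_seventeen`). -/
theorem c025_five_large_sharp27 (M : Matroid α) [M.Finite] (p : ℕ) (hp : 27 ≤ p) : RLS M p 5 :=
  c025_five_of_four_sharp_from 26 le_rfl (fun M _ p hp => S1.c025_four_seventeen M p (by omega)) M p hp

/-- The level-`5` statement at `p ≥ 27` in the vocabulary of `C025`. -/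
theorem c025_five_large_sharp27' (M : Matroid α) [M.Finite] (p : ℕ) (hp : 27 ≤ p) :
    phiK p 5 * ({A : Set α | A ⊆ M.E ∧ M.eRk A = (p : ℕ∞) ∧ M.eRk (M.E \ A) = (5 : ℕ∞)}.ncard : ℚ) ≤
      ({A : Set α | A ⊆ M.E ∧ (5 : ℕ∞) < M.eRk A ∧ M.eRk A < (p : ℕ∞)}.ncard : ℚ) :=
  c025_five_large_sharp27 M p hp

end ThmN

end PercRepro
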